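import Summits.ResolutionOfSingularities.ResolutionOfSingularities.Theorems.FrobeniusLadderFInjectiveMacaulayficationP2d4F5Specimen
import Summits.ResolutionOfSingularities.ResolutionOfSingularities.Theorems.FrobeniusLadderFInjectiveMacaulayficationStrictTransformChartN
import Summits.ResolutionOfSingularities.ResolutionOfSingularities.Theorems.FrobeniusLadderFInjectiveMacaulayficationPrimeTransfer
import Summits.ResolutionOfSingularities.ResolutionOfSingularities.Theorems.FrobeniusLadderFInjectiveMacaulayficationHypersurfaceOriginNotFull
import HarnessLib

/-!
# NEG-N, FLOOR 3 (chart step and the bad half of the locus lemma): `U₃ = Spec k[x,y,u,t,z]/(g₃)`, `g₃ = z² + x³z + y³+u³+t³`;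
# the `x`-chart of `Bl_𝔪 U₃` is `U₄ = Spec k[X]/(g₄)`, `g₄ = z² + x²z + x(y³+u³+t³)`; the origin of `U₃` is NOT FULL
# (crux `FInjectiveMacaulayfication` stmt-ResolutionOfSingularities-15315, chain w45a; res-L1-w45a-plan-1 g19 RULING R19.21 «NEG-N: an unconditional kernel
# refutation of `Recipes.NonFullTowerConjecture` on the period-one bed d4lx6c3», floors NEG-1/3/5 → stub-1 (split proposed l.≈81650); floor table =
# res-L1-w45a-tri-2 g16's replay l.81567 (`k = 3: g₃, I₁ = (t,u,x,y,z), S₃ = 𝔪, Bl 𝔪 @x`); twin of this seat's `…NonFullLoopFloorOne`; seat res-L1-w45a-stub-1 g11; pattern = res-L1-w45a-stub-3's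
# `Lx6q7PointFloorCharts` (p639147) restricted to the ONE chart on the loop's path)

[OURS · L1 W4.5a] Support file (`--supports stmt-ResolutionOfSingularities-15315 --as helper`); replaces the role of NO printed item; NOT a statement of any
manuscript; def-free (the floor polynomials are hypotheses `g₃ g₄` with their defining equations); UNCONDITIONAL; `CharP k 2` (primality of `g₃` uses `2 = 0`).
AI-written (AI review is weaker than expert review).

`X 0 = x`, `X 1 = y`, `X 2 = u`, `X 3 = t`, `X 4 = z`.
* §1 ★ `theta_x` — the chart identity `g₃(x, xy, xu, xt, xz) = x²·g₄` (`ring`); `prime_g₃` (Eisenstein-type at `(x,y,u,t) = (0,1,1,0)`: `T² + C(x³)T + C(y³+u³+t³)`,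
  `y³+u³+t³ = 2 = 0` and `∂/∂y = 3y² = 1` there, `char k = 2`); `g₃_not_mem_span_X0`, `g₄_not_mem_span_X0` (evaluate at `e_z`), `prime_g₄` (prime transfer along `θ_x`,
  `PrimeTransfer.stub_primeTransfer`), `g₃_ne_zero`, `g₄_ne_zero`;
* §2 ★★ `exists_chartEquiv_x` — `k[X]/(g₄) ≃+*` the Rees chart `D(x̄t)` of `Bl_𝔪 U₁` (`𝔪 = (x̄,ȳ,ū,t̄,z̄)` the origin of `U₁`), sending `x̄ ↦ x̄/1`
  (`StrictTransformChartN.stub_strictTransformChartN`): THE FLOOR-3 → FLOOR-4 LINK of the N-tower (U₄ is an open of `Bl_{S₃} U₃`, `S₃ = 𝔪`);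
  `cmCl_localization_g₃` / `cmCl_localization_g₄` (hypersurfaces are CM);
* §3 ★★ `g₃_mem_bracket` (`g₃ = z·z + x²·xz + y²·y + u²·u + t²·t ∈ 𝔪^{[2]}`), `constantCoeff_g₃`, `isMaximal_origin`, ★★ `origin_not_fullCl` —
  THE ORIGIN OF `U₃` IS NOT FULL (Fedder necessity, p603303 `HypersurfaceOriginNotFull.not_fullCl_stalk_origin_of_fedder_mem`): the «⊇» half of the floor-3 locus
  lemma «nonFull(U₃) = V(𝔪)»; the «⊆» half (FULL at every other point: parity-class root coefficients `z | x | y | u | t`) is the sequel file.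
[cite: GortzWedhorn2020, (13.19)] [cite: Fedder1983, Prop. 1.7] [cite: Matsumura1987, Thm. 17.4]
-/

-- single-problem summit: the doubled namespace component is forced
set_option linter.dupNamespace false

noncomputable section

open AlgebraicGeometry CategoryTheory Literature.AlgebraicGeometry.Resolution TopologicalSpace IsLocalRing MvPolynomial

namespace Summit.ResolutionOfSingularities.ResolutionOfSingularities.Theorems.FInjectiveMacaulayfication.NonFullLoopFloorThree

open Summit.ResolutionOfSingularities.ResolutionOfSingularities.Theorems.FInjectiveMacaulayfication
open SliceableCentre GermForm GermOfGlobalBlowup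

variable (k : Type) [Field k]

/-! ## §1 The chart identity, primality -/

/-- ★ **THE CHART IDENTITY OF FLOOR 3**: `g₃(x, xy, xu, xt, xz) = x²·g₄` — the `x`-chart of the blow-up of `U₃` at its origin has strict transform `g₄`. [folklore] -/
theorem theta_x (g₃ : MvPolynomial (Fin 5) k) (hg₃ : g₃ = X 4 ^ 2 + X 0 ^ 3 * X 4 + X 1 ^ 3 + X 2 ^ 3 + X 3 ^ 3)
    (g₄ : MvPolynomial (Fin 5) k) (hg₄ : g₄ = X 4 ^ 2 + X 0 ^ 2 * X 4 + X 0 * X 1 ^ 3 + X 0 * X 2 ^ 3 + X 0 * X 3 ^ 3) :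
    aeval (fun j : Fin 5 => if j = 0 then (X 0 : MvPolynomial (Fin 5) k) else X j * X 0) g₃ = X 0 ^ 2 * g₄ := by
  subst hg₃; subst hg₄
  simp
  ring

/-- **`g₃` is PRIME** (`char k = 2`): as `T² + C(x³)T + C(y³+u³+t³)` over `k[x,y,u,t]`, Eisenstein-type at `(0,1,1,0)` (`x³ = 0`, `y³+u³+t³ = 2 = 0`,
`∂/∂y = 3y² = 1 ≠ 0`). [folklore; `irreducible_X_pow_add_C_mul_X_add_C`] -/
theorem prime_g₃ [CharP k 2] (g₃ : MvPolynomial (Fin 5) k) (hg₃ : g₃ = X 4 ^ 2 + X 0 ^ 3 * X 4 + X 1 ^ 3 + X 2 ^ 3 + X 3 ^ 3) : Prime g₃ := by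
  set e : MvPolynomial (Fin 5) k ≃+* Polynomial (MvPolynomial (Fin 4) k) :=
    ((renameEquiv k (_root_.finRotate 5)).trans (finSuccEquiv k 4)).toRingEquiv with he_def
  have hrot4 : (_root_.finRotate 5) (4 : Fin 5) = 0 := by decide
  have hrot : ∀ j : Fin 4, (_root_.finRotate 5) (Fin.castSucc j) = j.succ := by decide
  have he4 : e (X 4) = Polynomial.X := by
    show finSuccEquiv k 4 (rename _ (X 4)) = _
    rw [rename_X, hrot4]; exact finSuccEquiv_X_zero
  have hej : ∀ j : Fin 4, e (X (Fin.castSucc j)) = Polynomial.C (X j) := fun j => by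
    show finSuccEquiv k 4 (rename _ (X (Fin.castSucc j))) = _
    rw [rename_X, hrot j]; exact finSuccEquiv_X_succ (j := j)
  set b : MvPolynomial (Fin 4) k := X 0 ^ 3 with hb
  set c : MvPolynomial (Fin 4) k := X 1 ^ 3 + X 2 ^ 3 + X 3 ^ 3 with hc
  have hef : e g₃ = Polynomial.X ^ 2 + Polynomial.C b * Polynomial.X + Polynomial.C c := by
    rw [hg₃, map_add, map_add, map_add, map_add, map_pow, map_mul, map_pow, he4, map_pow, map_pow, map_pow,
      show (0 : Fin 5) = Fin.castSucc (0 : Fin 4) from rfl, show (1 : Fin 5) = Fin.castSucc (1 : Fin 4) from rfl,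
      show (2 : Fin 5) = Fin.castSucc (2 : Fin 4) from rfl, show (3 : Fin 5) = Fin.castSucc (3 : Fin 4) from rfl, hej, hej, hej, hej, hb, hc]
    simp only [map_add, map_pow]
    ring
  set a : Fin 4 → k := ![0, 1, 1, 0] with ha
  have h2 : (2 : k) = 0 := by simpa using CharP.cast_eq_zero k 2
  have h3 : (3 : k) = 1 := by
    calc (3 : k) = 2 + 1 := by norm_num
      _ = 1 := by rw [h2]; ring
  have hba : MvPolynomial.eval a b = 0 := by rw [hb, map_pow, eval_X, ha]; simp
  have hca : MvPolynomial.eval a c = 0 := by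
    rw [hc]
    simp only [map_add, map_pow, eval_X, ha, Matrix.cons_val_zero, Matrix.cons_val_one]
    simp only [Matrix.cons_val, one_pow, zero_pow (by norm_num : (3 : ℕ) ≠ 0), add_zero]
    rw [show (1 : k) + 1 = 2 by norm_num, h2]
  have hder : MvPolynomial.eval a (pderiv 1 c) ≠ 0 := by
    have e1 : pderiv 1 c = 3 * X 1 ^ 2 := by
      rw [hc, map_add, map_add, pderiv_pow, pderiv_X_self, pderiv_pow, pderiv_X_of_ne (show (2 : Fin 4) ≠ 1 by decide),
        pderiv_pow, pderiv_X_of_ne (show (3 : Fin 4) ≠ 1 by decide)]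
      push_cast
      ring
    rw [e1, map_mul, map_pow, eval_X, ha]
    simp only [Matrix.cons_val_one, Matrix.cons_val_zero, one_pow, mul_one]
    rw [map_ofNat, h3]
    exact one_ne_zero
  have hirr : Irreducible (e g₃) := by
    rw [hef]
    exact Literature.AlgebraicGeometry.Motives.SmoothHypersurface.irreducible_X_pow_add_C_mul_X_add_C (d := 2) le_rfl b c a hba hca 1 hder
  exact (MulEquiv.prime_iff e).mp hirr.prime

/-- `g₃ ∉ (x)`: at `e_z` (`z = 1`, others `0`) `g₃ = 1`. [folklore] -/
theorem g₃_not_mem_span_X0 (g₃ : MvPolynomial (Fin 5) k) (hg₃ : g₃ = X 4 ^ 2 + X 0 ^ 3 * X 4 + X 1 ^ 3 + X 2 ^ 3 + X 3 ^ 3) :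
    g₃ ∉ Ideal.span {(X 0 : MvPolynomial (Fin 5) k)} := by
  intro h
  rw [Ideal.mem_span_singleton] at h
  obtain ⟨c, hc⟩ := h
  have := congrArg (MvPolynomial.eval (Pi.single 4 1 : Fin 5 → k)) hc
  rw [hg₃] at this
  simp at this

/-- `g₄ ∉ (x)`: at `e_z` `g₄ = 1`. [folklore] -/
theorem g₄_not_mem_span_X0 (g₄ : MvPolynomial (Fin 5) k) (hg₄ : g₄ = X 4 ^ 2 + X 0 ^ 2 * X 4 + X 0 * X 1 ^ 3 + X 0 * X 2 ^ 3 + X 0 * X 3 ^ 3) :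
    g₄ ∉ Ideal.span {(X 0 : MvPolynomial (Fin 5) k)} := by
  intro h
  rw [Ideal.mem_span_singleton] at h
  obtain ⟨c, hc⟩ := h
  have := congrArg (MvPolynomial.eval (Pi.single 4 1 : Fin 5 → k)) hc
  rw [hg₄] at this
  simp at this

/-- `g₃ ≠ 0`, `g₄ ≠ 0`. [plumbing] -/
theorem g_ne_zero (g₃ : MvPolynomial (Fin 5) k) (hg₃ : g₃ = X 4 ^ 2 + X 0 ^ 3 * X 4 + X 1 ^ 3 + X 2 ^ 3 + X 3 ^ 3)
    (g₄ : MvPolynomial (Fin 5) k) (hg₄ : g₄ = X 4 ^ 2 + X 0 ^ 2 * X 4 + X 0 * X 1 ^ 3 + X 0 * X 2 ^ 3 + X 0 * X 3 ^ 3) : g₃ ≠ 0 ∧ g₄ ≠ 0 :=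
  ⟨fun h => g₃_not_mem_span_X0 k g₃ hg₃ (h ▸ Ideal.zero_mem _), fun h => g₄_not_mem_span_X0 k g₄ hg₄ (h ▸ Ideal.zero_mem _)⟩

/-- **`(g₄)` is prime** (prime transfer along `θ_x` from `(g₃)`). [folklore; `PrimeTransfer.stub_primeTransfer`] -/
theorem isPrime_span_g₄ [CharP k 2] (g₃ : MvPolynomial (Fin 5) k) (hg₃ : g₃ = X 4 ^ 2 + X 0 ^ 3 * X 4 + X 1 ^ 3 + X 2 ^ 3 + X 3 ^ 3)
    (g₄ : MvPolynomial (Fin 5) k) (hg₄ : g₄ = X 4 ^ 2 + X 0 ^ 2 * X 4 + X 0 * X 1 ^ 3 + X 0 * X 2 ^ 3 + X 0 * X 3 ^ 3) :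
    (Ideal.span {g₃}).IsPrime ∧ (Ideal.span {g₄}).IsPrime := by
  have h1 : (Ideal.span {g₃}).IsPrime := (Ideal.span_singleton_prime (prime_g₃ k g₃ hg₃).ne_zero).mpr (prime_g₃ k g₃ hg₃)
  exact ⟨h1, (PrimeTransfer.stub_primeTransfer k 5 0 g₃ g₄ 2 (theta_x k g₃ hg₃ g₄ hg₄) (g₃_not_mem_span_X0 k g₃ hg₃) (g₄_not_mem_span_X0 k g₄ hg₄)).mp h1⟩

/-! ## §2 The floor-1 → floor-2 link: `k[X]/(g₄)` is the `x`-chart of `Bl_𝔪 U₁`; CM -/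

set_option maxHeartbeats 800000 in
-- chart-ring types are expensive to unify (as in `StrictTransformChartN`)
/-- ★★ **`U₂ = Spec k[X]/(g₄)` IS THE REES CHART `D(x̄t)` OF THE BLOW-UP OF `U₁` AT ITS ORIGIN**: a ring isomorphism onto
`(A₁[𝔪t])_{(x̄t)}`, `A₁ = k[X]/(g₃)`, `𝔪 = (x̄, ȳ, ū, t̄, z̄)`, sending `x̄ ↦ x̄/1`. [folklore; `StrictTransformChartN.stub_strictTransformChartN`; cite: GortzWedhorn2020, (13.19)] -/
theorem exists_chartEquiv_x [CharP k 2] (g₃ : MvPolynomial (Fin 5) k) (hg₃ : g₃ = X 4 ^ 2 + X 0 ^ 3 * X 4 + X 1 ^ 3 + X 2 ^ 3 + X 3 ^ 3)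
    (g₄ : MvPolynomial (Fin 5) k) (hg₄ : g₄ = X 4 ^ 2 + X 0 ^ 2 * X 4 + X 0 * X 1 ^ 3 + X 0 * X 2 ^ 3 + X 0 * X 3 ^ 3) :
    ∃ e : (MvPolynomial (Fin 5) k ⧸ Ideal.span {g₄}) ≃+*
        HomogeneousLocalization.Away (reesGrading (Ideal.span (Set.range (fun j : Fin 5 => Ideal.Quotient.mk (Ideal.span {g₃}) (X j)))))
          (reesT ((fun j : Fin 5 => Ideal.Quotient.mk (Ideal.span {g₃}) (X j)) 0) (Ideal.subset_span (Set.mem_range_self 0))),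
      e (Ideal.Quotient.mk (Ideal.span {g₄}) (X 0)) =
        reesChartBase ((fun j : Fin 5 => Ideal.Quotient.mk (Ideal.span {g₃}) (X j)) 0) (Ideal.subset_span (Set.mem_range_self 0))
          ((fun j : Fin 5 => Ideal.Quotient.mk (Ideal.span {g₃}) (X j)) 0) := by
  obtain ⟨h1, h2⟩ := isPrime_span_g₄ k g₃ hg₃ g₄ hg₄
  exact StrictTransformChartN.stub_strictTransformChartN k 5 g₃ g₄ 0 2 h1 (g_ne_zero k g₃ hg₃ g₄ hg₄).1 h2
    (PrimeTransfer.X_not_mem_span_of_isPrime h2 (g₄_not_mem_span_X0 k g₄ hg₄)) (theta_x k g₃ hg₃ g₄ hg₄) _ rfl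

/-- The CM clause at every prime of `U₁` and of `U₂` (hypersurfaces in a regular ring). [cite: Matsumura1987, Thm. 17.4 (iii), Thm. 17.8] -/
theorem cmCl_localization (g₃ : MvPolynomial (Fin 5) k) (hg₃ : g₃ = X 4 ^ 2 + X 0 ^ 3 * X 4 + X 1 ^ 3 + X 2 ^ 3 + X 3 ^ 3)
    (g₄ : MvPolynomial (Fin 5) k) (hg₄ : g₄ = X 4 ^ 2 + X 0 ^ 2 * X 4 + X 0 * X 1 ^ 3 + X 0 * X 2 ^ 3 + X 0 * X 3 ^ 3) :
    (∀ Q : Spec (.of (MvPolynomial (Fin 5) k ⧸ Ideal.span {g₃})), CMCl (Localization.AtPrime Q.asIdeal)) ∧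
    (∀ Q : Spec (.of (MvPolynomial (Fin 5) k ⧸ Ideal.span {g₄})), CMCl (Localization.AtPrime Q.asIdeal)) :=
  ⟨fun Q => DoublePointFermatCubicGerm.cmCl_localization_hypersurface k g₃ (g_ne_zero k g₃ hg₃ g₄ hg₄).1 Q,
    fun Q => DoublePointFermatCubicGerm.cmCl_localization_hypersurface k g₄ (g_ne_zero k g₃ hg₃ g₄ hg₄).2 Q⟩

/-! ## §3 The origin of `U₁` is NOT FULL (the «⊇» half of the floor-1 locus lemma) -/

/-- ★★ `g₃ ∈ 𝔪^{[2]} = (x², y², u², t², z²)`: `g₃ = z·z + x²·xz + y²·y + u²·u + t²·t`. [certificate; cite: Fedder1983, Prop. 1.7] -/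
theorem g₃_mem_bracket (g₃ : MvPolynomial (Fin 5) k) (hg₃ : g₃ = X 4 ^ 2 + X 0 ^ 3 * X 4 + X 1 ^ 3 + X 2 ^ 3 + X 3 ^ 3) :
    g₃ ^ (2 - 1) ∈ Ideal.span (Set.range fun i : Fin 5 => (X i : MvPolynomial (Fin 5) k) ^ 2) := by
  rw [show (2 - 1 : ℕ) = 1 from rfl, pow_one, hg₃]
  have hsq : ∀ j : Fin 5, (X j : MvPolynomial (Fin 5) k) ^ 2 ∈ Ideal.span (Set.range fun i : Fin 5 => (X i : MvPolynomial (Fin 5) k) ^ 2) :=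
    fun j => Ideal.subset_span ⟨j, rfl⟩
  refine Ideal.add_mem _ (Ideal.add_mem _ (Ideal.add_mem _ (Ideal.add_mem _ (hsq 4) ?_) ?_) ?_) ?_
  · rw [show (X 0 : MvPolynomial (Fin 5) k) ^ 3 * X 4 = X 0 ^ 2 * (X 0 * X 4) by ring]
    exact Ideal.mul_mem_right _ _ (hsq 0)
  all_goals
    rw [show ∀ j : Fin 5, (X j : MvPolynomial (Fin 5) k) ^ 3 = X j ^ 2 * X j from fun j => by ring]
    exact Ideal.mul_mem_right _ _ (hsq _)

/-- `g₃` has no constant term. [plumbing] -/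
theorem constantCoeff_g₃ (g₃ : MvPolynomial (Fin 5) k) (hg₃ : g₃ = X 4 ^ 2 + X 0 ^ 3 * X 4 + X 1 ^ 3 + X 2 ^ 3 + X 3 ^ 3) :
    constantCoeff g₃ = 0 := by
  rw [hg₃]; simp [constantCoeff_X]

/-- The origin `(x̄, ȳ, ū, t̄, z̄)` of `U₁` is a maximal ideal. [folklore] -/
theorem isMaximal_origin (g₃ : MvPolynomial (Fin 5) k) (hg₃ : g₃ = X 4 ^ 2 + X 0 ^ 3 * X 4 + X 1 ^ 3 + X 2 ^ 3 + X 3 ^ 3) :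
    (Ideal.span (Set.range fun j : Fin 5 => Ideal.Quotient.mk (Ideal.span {g₃}) (X j))).IsMaximal :=
  DoublePointFermatCubicGerm.isMaximal_origin k g₃ (constantCoeff_g₃ k g₃ hg₃)

/-- ★★ **THE ORIGIN OF `U₁` IS NOT FULL** (stalk form): Fedder necessity `g₃ ∈ 𝔪^{[2]}`. [OURS · certificate; cite: Fedder1983, Prop. 1.7] -/
theorem origin_not_fullCl [CharP k 2] (g₃ : MvPolynomial (Fin 5) k) (hg₃ : g₃ = X 4 ^ 2 + X 0 ^ 3 * X 4 + X 1 ^ 3 + X 2 ^ 3 + X 3 ^ 3)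
    (v : Spec (.of (MvPolynomial (Fin 5) k ⧸ Ideal.span {g₃})))
    (hv : v.asIdeal = Ideal.span (Set.range fun j : Fin 5 => Ideal.Quotient.mk (Ideal.span {g₃}) (X j))) :
    ¬ FullCl 2 ((Spec (.of (MvPolynomial (Fin 5) k ⧸ Ideal.span {g₃}))).presheaf.stalk v) := by
  haveI : Fact (Nat.Prime 2) := ⟨Nat.prime_two⟩
  exact HypersurfaceOriginNotFull.not_fullCl_stalk_origin_of_fedder_mem 2 k g₃ (fun h => g₃_not_mem_span_X0 k g₃ hg₃ (h ▸ Ideal.zero_mem _))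
    (constantCoeff_g₃ k g₃ hg₃) (g₃_mem_bracket k g₃ hg₃) v hv

/-- ★★ **THE ORIGIN OF `U₁` IS NOT FULL** (localization form). [OURS · certificate] -/
theorem origin_not_fullCl_localization [CharP k 2] (g₃ : MvPolynomial (Fin 5) k) (hg₃ : g₃ = X 4 ^ 2 + X 0 ^ 3 * X 4 + X 1 ^ 3 + X 2 ^ 3 + X 3 ^ 3)
    (P : Ideal (MvPolynomial (Fin 5) k ⧸ Ideal.span {g₃})) [hP : P.IsPrime]
    (hPv : P = Ideal.span (Set.range fun j : Fin 5 => Ideal.Quotient.mk (Ideal.span {g₃}) (X j))) : ¬ FullCl 2 (Localization.AtPrime P) := by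
  intro hfull
  let v : Spec (.of (MvPolynomial (Fin 5) k ⧸ Ideal.span {g₃})) := ⟨P, hP⟩
  exact origin_not_fullCl k g₃ hg₃ v hPv (WFixAtNonClosedDimTwo.fullCl_of_ringEquiv 2 (Spec.stalkIso (.of _) v).commRingCatIsoToRingEquiv.symm hfull)

/-- The «⊇» half of the floor-1 locus lemma: every point of `V(𝔪) ⊂ U₁` (i.e. the origin) is NON-FULL. [OURS · certificate] -/
theorem not_fullCl_of_origin_le [CharP k 2] (g₃ : MvPolynomial (Fin 5) k) (hg₃ : g₃ = X 4 ^ 2 + X 0 ^ 3 * X 4 + X 1 ^ 3 + X 2 ^ 3 + X 3 ^ 3)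
    (s : Spec (.of (MvPolynomial (Fin 5) k ⧸ Ideal.span {g₃})))
    (hs : Ideal.span (Set.range fun j : Fin 5 => Ideal.Quotient.mk (Ideal.span {g₃}) (X j)) ≤ s.asIdeal) :
    ¬ FullCl 2 ((Spec (.of (MvPolynomial (Fin 5) k ⧸ Ideal.span {g₃}))).presheaf.stalk s) :=
  origin_not_fullCl k g₃ hg₃ s ((isMaximal_origin k g₃ hg₃).eq_of_le s.2.ne_top hs).symm

end Summit.ResolutionOfSingularities.ResolutionOfSingularities.Theorems.FInjectiveMacaulayfication.NonFullLoopFloorThree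

end
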